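import Mathlib
import HarnessLib
import Summits.Parity.GeneralizedHardyLittlewood.Theorems.DilatedChowla.Negative.DilatedChowlaGram

/-!
# `DilatedChowla` (stmt-Parity-13319): the signed Gram lever `AbsBias c → ¬ DilatedChowla`

Line `Sketch` (card `siegel-mirror`), stub `gram_signed`: a strengthening of the landed
Gram-positivity lever `not_dilatedChowla_of_coherentBias` (file `DilatedChowlaGram`) in which the
one-point sums of the dilated family need NOT share a sign.

The crux `LiouvilleMAD.DilatedChowla` bounds the pencil sums
`S c n n' M = Σ_{m ∈ (M,2M]} λ(mn+c) λ(mn'+c)` by `C · M^{1−κ}` uniformly in `1 ≤ n ≠ n' ≤ 2M`.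
Signed Gram positivity in the dilation variable: for the family of dilations `qν`, `1 ≤ ν ≤ V`, put
`w_ν = ±1` the sign of `P c (qν) M` and `F m = Σ_ν w_ν λ(m·qν + c)`.  Then

* `Σ_m F(m)² = Σ_{ν,ν'} w_ν w_ν' S c (qν) (qν') M ≤ V·M + V²·C·M^{1−κ} ≤ 2VM` once `V·C ≤ M^κ`
  (diagonal: `w_ν² = 1` and the trivial bound `S_self_le`; off-diagonal: `w_ν w_ν' S ≤ |S|` and
  the crux), while
* Cauchy–Schwarz over `m ∈ (M,2M]` and the absolute bias `|P c (qν) M| ≥ bM` give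
  `(VbM)² ≤ (Σ_ν |P c (qν) M|)² = (Σ_ν w_ν P c (qν) M)² = (Σ_m F m)² ≤ M · Σ_m F(m)² ≤ 2VM²`.

Hence `b²V ≤ 2`, contradicting `b²V ≥ 4`.  Elementary; no cited facts.  Also recorded: a coherent
bias is an absolute bias (`absBias_of_coherentBias`).
-/

noncomputable section

namespace Summit.Parity.GeneralizedHardyLittlewood.Theorems.DilatedChowla.Negative

open Summit.Parity.GeneralizedHardyLittlewood.Theses.LiouvilleMAD
open Summit.Parity.GeneralizedHardyLittlewood.Theorems.DilatedTableChowla.Negative (L)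
open Finset

/-! ## §1 The hypothesis: an absolute (unsigned) class bias -/

/-- **Absolute class bias at shift `c`**: as `CoherentBias c` but with no common sign — every
one-point sum along the dilations `qν`, `1 ≤ ν ≤ V`, has ABSOLUTE value `≥ bM`. -/
def AbsBias (c : ℤ) : Prop :=
  ∀ κ : ℝ, 0 < κ → ∀ C : ℝ, ∃ M q V : ℕ, ∃ b : ℝ,
    1 ≤ q ∧ 1 ≤ V ∧ q * V ≤ 2 * M ∧ 0 < b ∧ 4 ≤ b ^ 2 * V ∧ (V : ℝ) * C ≤ (M : ℝ) ^ κ ∧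
    ∀ ν : ℕ, 1 ≤ ν → ν ≤ V → b * M ≤ |P c (q * ν) M|

/-- A coherent bias is an absolute bias. -/
theorem absBias_of_coherentBias {c : ℤ} (h : CoherentBias c) : AbsBias c := by
  intro κ hκ C
  obtain ⟨M, q, V, b, σ, hσ, hq, hV, hqV, hb, hbV, hVC, hP⟩ := h κ hκ C
  refine ⟨M, q, V, b, hq, hV, hqV, hb, hbV, hVC, fun ν hν1 hνV => le_trans (hP ν hν1 hνV) ?_⟩
  rcases hσ with h1 | h1
  · rw [h1, one_mul]
    exact le_abs_self _
  · rw [h1, neg_one_mul]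
    exact neg_le_abs _

/-! ## §2 The signed Gram sum -/

/-- Signed variant of `gram_sum_le`: with weights `w ν = ±1`, if the pencil sums obey
`|S c n n' M| ≤ C · M^{1−κ}` for `1 ≤ n ≠ n' ≤ 2M`, then for `q ≥ 1`, `qV ≤ 2M`,
`0 ≤ C · M^{1−κ}` and `V · C · M^{1−κ} ≤ M` one has
`Σ_{ν,ν' ≤ V} w_ν w_ν' S c (qν) (qν') M ≤ 2VM`
(diagonal `w_ν² S = S ≤ M` each, off-diagonal `w_ν w_ν' S ≤ |S| ≤ C · M^{1−κ}` each). -/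
private theorem gsig_gram_sum_le {c : ℤ} {κ C : ℝ} {M q V : ℕ} {w : ℕ → ℝ}
    (hw : ∀ ν, w ν = 1 ∨ w ν = -1)
    (hC : ∀ n n' : ℕ, 1 ≤ n → 1 ≤ n' → n ≠ n' → n ≤ 2 * M → n' ≤ 2 * M →
      |S c n n' M| ≤ C * (M : ℝ) ^ (1 - κ))
    (hq : 1 ≤ q) (hqV : q * V ≤ 2 * M) (hC0 : 0 ≤ C * (M : ℝ) ^ (1 - κ))
    (hVT : (V : ℝ) * (C * (M : ℝ) ^ (1 - κ)) ≤ M) :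
    ∑ ν ∈ Icc 1 V, ∑ ν' ∈ Icc 1 V, w ν * w ν' * S c (q * ν) (q * ν') M ≤ 2 * (V : ℝ) * M := by
  -- `|w ν| = 1` and `w ν · w ν = 1`
  have habs : ∀ ν, |w ν| = 1 := fun ν => by
    rcases hw ν with h1 | h1 <;> norm_num [h1]
  have hsq : ∀ ν, w ν * w ν = 1 := fun ν => by
    rcases hw ν with h1 | h1 <;> norm_num [h1]
  -- entrywise bound
  have hentry : ∀ ν ∈ Icc 1 V, ∀ ν' ∈ Icc 1 V,
      w ν * w ν' * S c (q * ν) (q * ν') M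
        ≤ (if ν = ν' then (M : ℝ) else 0) + C * (M : ℝ) ^ (1 - κ) := by
    intro ν hν ν' hν'
    rw [mem_Icc] at hν hν'
    by_cases hνν' : ν = ν'
    · subst hνν'
      rw [if_pos rfl, hsq ν, one_mul]
      linarith [S_self_le c (q * ν) M]
    · rw [if_neg hνν', zero_add]
      calc w ν * w ν' * S c (q * ν) (q * ν') M
          ≤ |w ν * w ν' * S c (q * ν) (q * ν') M| := le_abs_self _
        _ = |S c (q * ν) (q * ν') M| := by
            rw [abs_mul, abs_mul, habs ν, habs ν', one_mul, one_mul]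
        _ ≤ C * (M : ℝ) ^ (1 - κ) := by
            refine hC (q * ν) (q * ν') ?_ ?_ ?_ ?_ ?_
            · exact (one_mul 1).symm.trans_le (Nat.mul_le_mul hq hν.1)
            · exact (one_mul 1).symm.trans_le (Nat.mul_le_mul hq hν'.1)
            · exact fun heq => hνν' (Nat.eq_of_mul_eq_mul_left (by omega) heq)
            · exact le_trans (Nat.mul_le_mul_left q hν.2) hqV
            · exact le_trans (Nat.mul_le_mul_left q hν'.2) hqV
  calc ∑ ν ∈ Icc 1 V, ∑ ν' ∈ Icc 1 V, w ν * w ν' * S c (q * ν) (q * ν') M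
      ≤ ∑ ν ∈ Icc 1 V, ∑ ν' ∈ Icc 1 V,
          ((if ν = ν' then (M : ℝ) else 0) + C * (M : ℝ) ^ (1 - κ)) :=
        sum_le_sum fun ν hν => sum_le_sum fun ν' hν' => hentry ν hν ν' hν'
    _ = ∑ _ν ∈ Icc 1 V, ((M : ℝ) + V * (C * (M : ℝ) ^ (1 - κ))) := by
        refine sum_congr rfl fun ν hν => ?_
        rw [sum_add_distrib, sum_ite_eq, if_pos hν, sum_const, Nat.card_Icc, Nat.add_sub_cancel,
          nsmul_eq_mul]
    _ ≤ ∑ _ν ∈ Icc 1 V, ((M : ℝ) + M) := sum_le_sum fun _ _ => by linarith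
    _ = 2 * (V : ℝ) * M := by
        rw [sum_const, Nat.card_Icc, Nat.add_sub_cancel, nsmul_eq_mul]
        ring

/-! ## §3 The signed Gram lever -/

/-- **Signed Gram lever**: an absolute class bias refutes the crux.  For `c ≠ 0`, an absolute class
bias at shift `c` (`AbsBias c`: for every `κ > 0` and `C`, a family of `V` progressions `c mod qν`,
`1 ≤ ν ≤ V`, `qV ≤ 2M`, whose one-point sums satisfy `|P c (qν) M| ≥ bM`, with `b²V ≥ 4` and
`V·C ≤ M^κ`) is incompatible with the crux `DilatedChowla`: with `w_ν = ±1` the sign of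
`P c (qν) M`, expanding `Σ_{m∈(M,2M]} (Σ_ν w_ν λ(m·qν+c))²` as the signed Gram sum
`Σ_{ν,ν'} w_ν w_ν' S c (qν) (qν') M ≤ 2VM` (crux off the diagonal) and bounding it below by
`(Σ_ν |P c (qν) M|)²/M ≥ V²b²M` (Cauchy–Schwarz) gives `b²V ≤ 2`. -/
theorem not_dilatedChowla_of_absBias {c : ℤ} (hc : c ≠ 0) (h : AbsBias c) :
    ¬ Summit.Parity.GeneralizedHardyLittlewood.Theses.LiouvilleMAD.DilatedChowla := by
  intro hD
  obtain ⟨κ, hκ, C, hC⟩ := dilatedChowla_iff.mp hD c hc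
  obtain ⟨M, q, V, b, hq, hV, hqV, hb, hbV, hVC, hP⟩ := h κ hκ C
  -- the sign weights `w ν = ±1` with `w ν · P c (qν) M = |P c (qν) M|`
  obtain ⟨w, hw, hwP⟩ : ∃ w : ℕ → ℝ, (∀ ν, w ν = 1 ∨ w ν = -1) ∧
      ∀ ν, w ν * P c (q * ν) M = |P c (q * ν) M| := by
    refine ⟨fun ν => if 0 ≤ P c (q * ν) M then 1 else -1, fun ν => ?_, fun ν => ?_⟩
    · show (if 0 ≤ P c (q * ν) M then (1 : ℝ) else -1) = 1 ∨
        (if 0 ≤ P c (q * ν) M then (1 : ℝ) else -1) = -1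
      by_cases h0 : 0 ≤ P c (q * ν) M
      · exact Or.inl (if_pos h0)
      · exact Or.inr (if_neg h0)
    · show (if 0 ≤ P c (q * ν) M then (1 : ℝ) else -1) * P c (q * ν) M = |P c (q * ν) M|
      by_cases h0 : 0 ≤ P c (q * ν) M
      · rw [if_pos h0, one_mul, abs_of_nonneg h0]
      · rw [if_neg h0, neg_one_mul, abs_of_neg (not_le.mp h0)]
  -- the scale is positive
  have hM : 1 ≤ M := by
    have := Nat.mul_le_mul hq hV
    omega
  have hMpos : (0 : ℝ) < M := Nat.cast_pos.mpr (by omega)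
  have hVpos : (0 : ℝ) < V := Nat.cast_pos.mpr (by omega)
  -- the crux constant is nonnegative (test it at `M = 1`, `n = 1`, `n' = 2`)
  have hC0 : 0 ≤ C := by
    have h12 := hC 1 1 2 le_rfl (by norm_num) (by norm_num) (by norm_num) (by norm_num)
    rw [Nat.cast_one, Real.one_rpow, mul_one] at h12
    exact le_trans (abs_nonneg _) h12
  have hT0 : 0 ≤ C * (M : ℝ) ^ (1 - κ) := mul_nonneg hC0 (Real.rpow_nonneg hMpos.le _)
  -- `V · C · M^{1−κ} ≤ M^κ · M^{1−κ} = M`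
  have hVT : (V : ℝ) * (C * (M : ℝ) ^ (1 - κ)) ≤ M := by
    have hsplit : (M : ℝ) ^ κ * (M : ℝ) ^ (1 - κ) = M := by
      rw [← Real.rpow_add hMpos]
      simp
    calc (V : ℝ) * (C * (M : ℝ) ^ (1 - κ)) = ((V : ℝ) * C) * (M : ℝ) ^ (1 - κ) := by ring
      _ ≤ (M : ℝ) ^ κ * (M : ℝ) ^ (1 - κ) :=
          mul_le_mul_of_nonneg_right hVC (Real.rpow_nonneg hMpos.le _)
      _ = M := hsplit
  -- UPPER BOUND for the signed Gram sum
  have hgram_le :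
      ∑ ν ∈ Icc 1 V, ∑ ν' ∈ Icc 1 V, w ν * w ν' * S c (q * ν) (q * ν') M ≤ 2 * (V : ℝ) * M :=
    gsig_gram_sum_le hw (hC M) hq hqV hT0 hVT
  -- GRAM EXPANSION of `Σ_m F(m)²`, `F m = Σ_ν w_ν λ(m·qν + c)`
  have hgram :
      ∑ m ∈ Ioc M (2 * M), (∑ ν ∈ Icc 1 V, w ν * L ((m : ℤ) * ((q * ν : ℕ) : ℤ) + c)) ^ 2
        = ∑ ν ∈ Icc 1 V, ∑ ν' ∈ Icc 1 V, w ν * w ν' * S c (q * ν) (q * ν') M := by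
    calc ∑ m ∈ Ioc M (2 * M), (∑ ν ∈ Icc 1 V, w ν * L ((m : ℤ) * ((q * ν : ℕ) : ℤ) + c)) ^ 2
        = ∑ ν ∈ Icc 1 V, ∑ ν' ∈ Icc 1 V, ∑ m ∈ Ioc M (2 * M),
            (w ν * L ((m : ℤ) * ((q * ν : ℕ) : ℤ) + c)) *
              (w ν' * L ((m : ℤ) * ((q * ν' : ℕ) : ℤ) + c)) :=
          sum_sq_sum_eq_gram (Ioc M (2 * M)) (Icc 1 V)
            (fun m ν => w ν * L ((m : ℤ) * ((q * ν : ℕ) : ℤ) + c))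
      _ = ∑ ν ∈ Icc 1 V, ∑ ν' ∈ Icc 1 V, w ν * w ν' * S c (q * ν) (q * ν') M := by
          refine sum_congr rfl fun ν _ => sum_congr rfl fun ν' _ => ?_
          unfold S
          rw [mul_sum]
          refine sum_congr rfl fun m _ => ?_
          ring
  -- `Σ_m F m = Σ_ν w_ν P c (qν) M = Σ_ν |P c (qν) M|`
  have hlin : ∑ m ∈ Ioc M (2 * M), ∑ ν ∈ Icc 1 V, w ν * L ((m : ℤ) * ((q * ν : ℕ) : ℤ) + c)
      = ∑ ν ∈ Icc 1 V, |P c (q * ν) M| := by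
    rw [sum_comm]
    refine sum_congr rfl fun ν _ => ?_
    rw [← hwP ν]
    unfold P
    rw [mul_sum]
  -- CAUCHY–SCHWARZ against the constant vector on `(M, 2M]` (`M` terms)
  have hcard : (Ioc M (2 * M)).card = M := by
    rw [Nat.card_Ioc]
    omega
  have hCS : (∑ ν ∈ Icc 1 V, |P c (q * ν) M|) ^ 2
      ≤ (M : ℝ) * ∑ ν ∈ Icc 1 V, ∑ ν' ∈ Icc 1 V, w ν * w ν' * S c (q * ν) (q * ν') M := by
    have := sq_sum_le_card_mul_sum_sq (s := Ioc M (2 * M))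
      (f := fun m => ∑ ν ∈ Icc 1 V, w ν * L ((m : ℤ) * ((q * ν : ℕ) : ℤ) + c))
    rw [hcard, hlin, hgram] at this
    exact this
  -- LOWER BOUND from the absolute bias: `V·b·M ≤ Σ_ν |P c (qν) M|`
  have hbias : (V : ℝ) * (b * M) ≤ ∑ ν ∈ Icc 1 V, |P c (q * ν) M| := by
    have hconst : ∑ _ν ∈ Icc 1 V, b * (M : ℝ) = (V : ℝ) * (b * M) := by
      rw [sum_const, Nat.card_Icc, Nat.add_sub_cancel, nsmul_eq_mul]
    rw [← hconst]
    refine sum_le_sum fun ν hν => ?_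
    rw [mem_Icc] at hν
    exact hP ν hν.1 hν.2
  have h0 : (0 : ℝ) ≤ V * (b * M) :=
    mul_nonneg (Nat.cast_nonneg V) (mul_nonneg hb.le (Nat.cast_nonneg M))
  have hsq : ((V : ℝ) * (b * M)) ^ 2 ≤ (∑ ν ∈ Icc 1 V, |P c (q * ν) M|) ^ 2 :=
    pow_le_pow_left₀ h0 hbias 2
  have hMG : (M : ℝ) * ∑ ν ∈ Icc 1 V, ∑ ν' ∈ Icc 1 V, w ν * w ν' * S c (q * ν) (q * ν') M
      ≤ (M : ℝ) * (2 * (V : ℝ) * M) := mul_le_mul_of_nonneg_left hgram_le hMpos.le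
  -- CONCLUSION: `V²b²M² ≤ 2VM²` against `4 ≤ b²V`
  have hVM : (0 : ℝ) < V * M ^ 2 := mul_pos hVpos (pow_pos hMpos 2)
  have hprod : 4 * ((V : ℝ) * M ^ 2) ≤ b ^ 2 * V * ((V : ℝ) * M ^ 2) :=
    mul_le_mul_of_nonneg_right hbV hVM.le
  nlinarith [hsq, hCS, hMG, hprod, hVM]

end Summit.Parity.GeneralizedHardyLittlewood.Theorems.DilatedChowla.Negative

end
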